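import Summits.BirchSwinnertonDyer.BirchSwinnertonDyer.Theorems.ManinLocalTwoThreeShimuraQuotientCuspidalInertia
import Literature.NumberTheory.EllipticCurves.ShimuraSubgroupEisensteinProofs
import Summits.BirchSwinnertonDyer.Rank1Residual.ManinAdditive.ShimuraKronecker
import HarnessLib

/-!
# The period character of `Λ₀(f)/Λ₁(f)` IS a Shimura two-character (`SigmaEta.IsShimuraTwoChar`) — hence a KRONECKER SYMBOL
# `(q | d_γ)` (an's E-an-158), BY NAME: the bridge from the period lattice to the cell's `Σ(N)[2] = η²` framework
Summit `BirchSwinnertonDyer`, route `ManinLocalTwoThree` (cell bsd-f2-manin), deciding crux C2 `ManinOddAtFour` (stmt-BirchSwinnertonDyer-22967);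
lead p1 gen 15.  The an planner's `Σ(N)[2]` framework (`…ManinAdditive/SigmaEtaKummer`, `SigmaTwoEta`, `ShimuraKronecker`) DEFINES a
Shimura two-character as an even quadratic Dirichlet character mod `N` killing every cusp-stabiliser entry `d = 1 + a·c·(N/gcd(N,c²))`
(`SigmaEta.IsShimuraTwoChar`) and PROVES E-an-158 `SigmaEta.shimuraTwoCharIsKronecker` (such a character is `(q | ·)` for an admissible
squarefree `q ∣ N`).  What was missing is the PERIOD side: that the class map `γ ↦ {∞, γ∞}_f mod Λ₁(f)` of a cusp form kills those entries.
This file supplies it (the general parabolic of `…ShimuraQuotientCuspidalInertia` at an arbitrary cusp `a/c`) and draws the by-name consequence.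
* §1 `exists_parabolic_fixing` — for `N ∣ h·c²`: `(1 − hac, ha²; −hc², 1 + hac) ∈ Γ₀(N)` fixes `a/c`, has zero period and `d = 1 + h·a·c`;
  `cuspSymbol_mem_periodLatticeGamma1_of_apply_eq_cuspStabiliser` — `d_γ ≡ 1 + a·c·(N/gcd(N,c²)) (mod N)`, `c ∣ N` ⟹ `{∞, γ∞}_f ∈ Λ₁(f)`.
* §2 **`isShimuraTwoChar_of_represents`** — ANY `χ : DirichletCharacter ℤ N` REPRESENTING the period class of `f`
  (`χ(d_γ) = 1 ⟺ {∞, γ∞}_f ∈ Λ₁(f)` for all `γ ∈ Γ₀(N)`) satisfies `IsShimuraTwoChar N χ`; hence (**`exists_jacobiSym_represents_of_represents`**,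
  E-an-158 by name, `4 ∣ N`): `{∞, γ∞}_f ∈ Λ₁(f) ⟺ (q | d_γ) = 1` for an admissible squarefree `q ∣ N`.
* §3 **`exists_dirichletChar_represents_of_two_classes`** — if `Λ₀/Λ₁` has at most two classes (`∀ z ∈ Λ₀, z ∈ Λ₁ ∨ z − x₀ ∈ Λ₁` with
  `2x₀ ∈ Λ₁`) then a representing character EXISTS (`MulChar.ofUnitHom` of the sign `u ↦ ±1`); with §2:
  **`exists_jacobiSym_represents_of_two_classes`**, and at the cyclic levels of `…CuspidalInertia` (units of `ℤ/uv` `= ±u₀^k`, `N = u²v`,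
  `4 ∣ N`): **`exists_jacobiSym_represents_of_generator_mod`** — for every NEWFORM datum there, `Λ₁(f) = {periods of γ with (q | d_γ) = +1}`-class
  for one admissible squarefree `q ∣ N` (e.g. `q = p` at `N = 4p`, `8p`, `16p`; `q ∈ {1, 2}` at `N = 32, 64, 128, 256`).
HONEST FRAMING: unconditional structure theorems (which `q`, and whether the class is trivial, is NOT decided); they do not prove C2, Manin's
conjecture or BSD.  No definitions (existence statements only), no sorry.
[cite: LingOesterle1991, §1 and Thm. 1] [cite: Stevens1989, §2] [cite: Manin1972, Prop. 1.4 / Thm. 1.6]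
-/

set_option autoImplicit false
-- the summit-side namespace `Summit.BirchSwinnertonDyer.BirchSwinnertonDyer.…` is the tree's (summit = sub-problem)
set_option linter.dupNamespace false

noncomputable section

open scoped MatrixGroups ModularForm NumberTheorySymbols

open CongruenceSubgroup WeierstrassCurve Literature.NumberTheory.EllipticCurves
  Literature.NumberTheory.EllipticCurves.ModularForms
  Summit.BirchSwinnertonDyer.Rank1Residual.ManinAdditive

namespace Summit.BirchSwinnertonDyer.BirchSwinnertonDyer.Theorems.ManinLocalTwoThree

variable {N : ℕ} [NeZero N] (f : CuspForm (Gamma0 N) 2)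

/-! ## §1 The parabolic fixing an arbitrary cusp `a/c` -/

/-- **The parabolic at `a/c`.**  If `N ∣ h·c²` then `ρ = (1 − hac, ha²; −hc², 1 + hac) ∈ Γ₀(N)`, `ρ` fixes `a/c` (any integers `a, c`;
for `c = 0` it is unipotent at `∞`), so `{∞, ρ∞}_f = 0`, and `d_ρ = 1 + h·a·c`. [cite: Manin1972, Prop. 1.4 / Thm. 1.6] -/
theorem exists_parabolic_fixing (a c h : ℤ) (hN : (N : ℤ) ∣ h * c ^ 2) :
    ∃ ρ : Gamma0 N, cuspSymbol f ρ = 0 ∧ (((ρ : SL(2, ℤ)) 1 1 : ℤ) = 1 + h * a * c) := by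
  let M : SL(2, ℤ) := ⟨!![1 - h * a * c, h * a ^ 2; -(h * c ^ 2), 1 + h * a * c], by
    rw [Matrix.det_fin_two_of]; ring⟩
  have hM : M ∈ Gamma0 N := by
    rw [Gamma0_mem]
    simp only [M, Matrix.of_apply, Matrix.cons_val', Matrix.cons_val_zero, Matrix.cons_val_one,
      Matrix.cons_val_fin_one]
    obtain ⟨k, hk⟩ := hN
    have : ((h * c ^ 2 : ℤ) : ZMod N) = 0 := by rw [hk]; push_cast; rw [ZMod.natCast_self, zero_mul]
    push_cast at this ⊢
    rw [this, neg_zero]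
  refine ⟨⟨M, hM⟩, ?_, ?_⟩
  · by_cases hc : c = 0
    · -- lower-left entry `0`: the symbol is `0` by definition
      unfold cuspSymbol
      simp only [M, Matrix.of_apply, Matrix.cons_val', Matrix.cons_val_zero, Matrix.cons_val_one,
        Matrix.cons_val_fin_one, hc]
      simp
    · have hc' : (c : ℚ) ≠ 0 := by exact_mod_cast hc
      have hden : (-((h : ℚ) * c ^ 2)) * (a / c) + (1 + h * a * c) = 1 := by field_simp; ring
      have hr : ((((⟨M, hM⟩ : Gamma0 N) : SL(2, ℤ)) 1 0 : ℤ) : ℚ) * (a / c) +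
          ((((⟨M, hM⟩ : Gamma0 N) : SL(2, ℤ)) 1 1 : ℤ) : ℚ) ≠ 0 := by
        simp only [M, Matrix.of_apply, Matrix.cons_val', Matrix.cons_val_zero, Matrix.cons_val_one,
          Matrix.cons_val_fin_one]
        push_cast
        rw [hden]; exact one_ne_zero
      have key := modularSymbol_gamma0_smul_holds f ⟨M, hM⟩ (a / c) hr
      have harg : ((((⟨M, hM⟩ : Gamma0 N) : SL(2, ℤ)) 0 0 : ℤ) : ℚ) * (a / c) +
          ((((⟨M, hM⟩ : Gamma0 N) : SL(2, ℤ)) 0 1 : ℤ) : ℚ) = a / c := by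
        simp only [M, Matrix.of_apply, Matrix.cons_val', Matrix.cons_val_zero, Matrix.cons_val_one,
          Matrix.cons_val_fin_one]
        push_cast
        field_simp; ring
      have hden' : ((((⟨M, hM⟩ : Gamma0 N) : SL(2, ℤ)) 1 0 : ℤ) : ℚ) * (a / c) +
          ((((⟨M, hM⟩ : Gamma0 N) : SL(2, ℤ)) 1 1 : ℤ) : ℚ) = 1 := by
        simp only [M, Matrix.of_apply, Matrix.cons_val', Matrix.cons_val_zero, Matrix.cons_val_one,
          Matrix.cons_val_fin_one]
        push_cast
        exact hden
      rw [harg, hden', div_one] at key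
      linear_combination -key
  · simp only [M, Matrix.of_apply, Matrix.cons_val', Matrix.cons_val_one, Matrix.cons_val_fin_one]

omit [NeZero N] in
/-- `N ∣ (N / gcd(N, c²))·c²` (the cusp width times `c²`). -/
theorem level_dvd_width_mul_sq (c : ℕ) : (N : ℤ) ∣ ((N / Nat.gcd N (c * c) : ℕ) : ℤ) * (c : ℤ) ^ 2 := by
  set g := Nat.gcd N (c * c) with hg
  obtain ⟨k, hk⟩ : g ∣ c * c := Nat.gcd_dvd_right N (c * c)
  have hgN : g ∣ N := Nat.gcd_dvd_left N (c * c)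
  refine ⟨k, ?_⟩
  have h : (N / g) * (c * c) = N * k := by
    rw [hk, ← mul_assoc, Nat.div_mul_cancel hgN]
  have h' : ((N / g : ℕ) : ℤ) * (c : ℤ) ^ 2 = ((N / g * (c * c) : ℕ) : ℤ) := by push_cast; ring
  rw [h', h]; push_cast; ring

/-- **Cusp-stabiliser entries kill the period**: if `c ∣ N` and `d_γ ≡ 1 + a·c·(N/gcd(N,c²)) (mod N)` then `{∞, γ∞}_f ∈ Λ₁(f)` — the
inertia clause of `SigmaEta.IsShimuraTwoChar`, on the period side. [cite: LingOesterle1991, §1] [cite: Manin1972, Prop. 1.4 / Thm. 1.6] -/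
theorem cuspSymbol_mem_periodLatticeGamma1_of_apply_eq_cuspStabiliser (a c : ℕ) (γ : Gamma0 N)
    (hd : ((((γ : SL(2, ℤ)) 1 1 : ℤ)) : ZMod N) = ((1 + a * c * (N / Nat.gcd N (c * c)) : ℕ) : ZMod N)) :
    cuspSymbol f γ ∈ periodLatticeGamma1 f := by
  have hdiv := level_dvd_width_mul_sq (N := N) c
  generalize hw : N / Nat.gcd N (c * c) = w at hd hdiv
  obtain ⟨ρ, hρ0, hρ11⟩ := exists_parabolic_fixing f (a : ℤ) (c : ℤ) (w : ℤ) hdiv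
  have h := cuspSymbol_sub_mem_periodLatticeGamma1_of_apply_eq f ρ γ (by rw [hρ11, hd]; push_cast; ring)
  rwa [hρ0, sub_zero] at h

/-! ## §2 A representing character is a Shimura two-character, hence a Kronecker symbol -/

/-- **THE BRIDGE.**  Any `ℤ`-valued Dirichlet character `χ mod N` that REPRESENTS the period class of `f` — `χ(d_γ) = 1 ⟺ {∞, γ∞}_f ∈ Λ₁(f)`
for every `γ ∈ Γ₀(N)` — is a Shimura two-character in the sense of the cell's `Σ(N)[2]` framework (`SigmaEta.IsShimuraTwoChar`): it is even
(`−1 = d_{−I}`, zero period) and kills every cusp-stabiliser entry (§1). [cite: LingOesterle1991, §1 and Thm. 1] -/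
theorem isShimuraTwoChar_of_represents (χ : DirichletCharacter ℤ N)
    (hχ : ∀ γ : Gamma0 N, χ ((((γ : SL(2, ℤ)) 1 1 : ℤ) : ZMod N)) = 1 ↔ cuspSymbol f γ ∈ periodLatticeGamma1 f) :
    SigmaEta.IsShimuraTwoChar N χ := by
  refine ⟨?_, fun a c _hc _hac ↦ ?_⟩
  · obtain ⟨δ, -, -, h11, hδ⟩ := exists_neg_entries_cuspSymbol_eq f 1
    have hmem : cuspSymbol f δ ∈ periodLatticeGamma1 f := by rw [hδ, cuspSymbol_one]; exact zero_mem _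
    have h := (hχ δ).mpr hmem
    rw [h11] at h
    simpa using h
  · have hdiv := level_dvd_width_mul_sq (N := N) c
    generalize N / Nat.gcd N (c * c) = w at hdiv ⊢
    obtain ⟨ρ, hρ0, hρ11⟩ := exists_parabolic_fixing f (a : ℤ) (c : ℤ) (w : ℤ) hdiv
    have hmem : cuspSymbol f ρ ∈ periodLatticeGamma1 f := by rw [hρ0]; exact zero_mem _
    have h := (hχ ρ).mpr hmem
    rw [hρ11] at h
    convert h using 2
    push_cast; ring

/-- The lower-right entry of `γ ∈ Γ₀(N)` is prime to `N`, and odd when `N` is even. [cite: DiamondShurman2005, §1.2] -/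
theorem odd_and_isCoprime_apply_one_one (h2 : 2 ∣ N) (γ : Gamma0 N) :
    Odd (((γ : SL(2, ℤ)) 1 1 : ℤ)) ∧ IsCoprime (((γ : SL(2, ℤ)) 1 1 : ℤ)) (N : ℤ) := by
  have hcop : IsCoprime (N : ℤ) (((γ : SL(2, ℤ)) 1 1 : ℤ)) :=
    (ZMod.coe_int_isUnit_iff_isCoprime _ N).mp (isUnit_apply_one_one γ)
  have h2d : IsCoprime (2 : ℤ) (((γ : SL(2, ℤ)) 1 1 : ℤ)) :=
    hcop.of_isCoprime_of_dvd_left (by exact_mod_cast h2)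
  refine ⟨?_, hcop.symm⟩
  rcases Int.even_or_odd (((γ : SL(2, ℤ)) 1 1 : ℤ)) with heven | hodd
  · exfalso
    have hu := h2d.isUnit_of_dvd' (dvd_refl 2) (even_iff_two_dvd.mp heven)
    rw [Int.isUnit_iff] at hu
    omega
  · exact hodd

/-- **THE SHIMURA CHARACTER OF A CUSP FORM IS A KRONECKER SYMBOL** (E-an-158 `SigmaEta.shimuraTwoCharIsKronecker` BY NAME, through the
bridge): at `4 ∣ N`, if `χ` represents the period class of `f`, then for one admissible squarefree `q ∣ N` (odd unless `32 ∣ N`, `≡ 1 (mod 4)`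
unless `8 ∣ N`): `{∞, γ∞}_f ∈ Λ₁(f) ⟺ (q | d_γ) = +1` for every `γ ∈ Γ₀(N)`. [cite: LingOesterle1991, §1 and Thm. 1] -/
theorem exists_jacobiSym_represents_of_represents (h4 : 4 ∣ N) (χ : DirichletCharacter ℤ N)
    (hχ : ∀ γ : Gamma0 N, χ ((((γ : SL(2, ℤ)) 1 1 : ℤ) : ZMod N)) = 1 ↔ cuspSymbol f γ ∈ periodLatticeGamma1 f) :
    ∃ q : ℕ, Squarefree q ∧ q ∣ N ∧ (¬ 32 ∣ N → Odd q) ∧ (¬ 8 ∣ N → q % 4 = 1) ∧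
      ∀ γ : Gamma0 N, cuspSymbol f γ ∈ periodLatticeGamma1 f ↔ J(q | (((γ : SL(2, ℤ)) 1 1 : ℤ)).natAbs) = 1 := by
  obtain ⟨q, hsq, hqN, h32, h8, hval⟩ :=
    SigmaEta.shimuraTwoCharIsKronecker N h4 (NeZero.ne N) χ (isShimuraTwoChar_of_represents f χ hχ)
  refine ⟨q, hsq, hqN, h32, h8, fun γ ↦ ?_⟩
  obtain ⟨hodd, hcop⟩ := odd_and_isCoprime_apply_one_one ((show (2 : ℕ) ∣ 4 by norm_num).trans h4) γ
  rw [← hχ γ, hval _ hodd hcop]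

/-! ## §3 A representing character EXISTS whenever the Shimura quotient has at most two classes -/

/-- **Two classes ⟹ a representing character exists.**  If `2x₀ ∈ Λ₁(f)` and every period is `≡ 0` or `≡ x₀ (mod Λ₁(f))`, then the sign
`d ↦ ±1` (`+1` iff the class of `d` is trivial) is a well-defined quadratic Dirichlet character mod `N` representing the period class.
(Existence only; the character is `MulChar.ofUnitHom` of the sign on `(ℤ/N)ˣ`.) [cite: LingOesterle1991, §1 and Thm. 1] [cite: Stevens1989, §2] -/
theorem exists_dirichletChar_represents_of_two_classes {x₀ : ℂ} (h2x₀ : 2 * x₀ ∈ periodLatticeGamma1 f)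
    (htwo : ∀ z ∈ periodLattice f, z ∈ periodLatticeGamma1 f ∨ z - x₀ ∈ periodLatticeGamma1 f) :
    ∃ χ : DirichletCharacter ℤ N, ∀ γ : Gamma0 N,
      χ ((((γ : SL(2, ℤ)) 1 1 : ℤ) : ZMod N)) = 1 ↔ cuspSymbol f γ ∈ periodLatticeGamma1 f := by
  classical
  have hγ : ∀ u : (ZMod N)ˣ, ∃ γ : Gamma0 N, (((γ : SL(2, ℤ)) 1 1 : ℤ) : ZMod N) = u :=
    fun u ↦ exists_gamma0_apply_one_one_eq_of_isUnit u.isUnit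
  choose g hg using hγ
  -- the class of `{∞, γ∞}` only depends on `d_γ`
  have hclass : ∀ (γ : Gamma0 N) (u : (ZMod N)ˣ), (((γ : SL(2, ℤ)) 1 1 : ℤ) : ZMod N) = u →
      (cuspSymbol f γ ∈ periodLatticeGamma1 f ↔ cuspSymbol f (g u) ∈ periodLatticeGamma1 f) := by
    intro γ u hu
    have h := cuspSymbol_sub_mem_periodLatticeGamma1_of_apply_eq f (g u) γ (by rw [hg, hu])
    constructor
    · intro hγm; simpa using sub_mem hγm h
    · intro hgm; simpa using add_mem h hgm
  -- two classes ⟹ the class of a sum is the "sum" of the classes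
  have hsum : ∀ {z w : ℂ}, z ∈ periodLattice f → w ∈ periodLattice f →
      (z + w ∈ periodLatticeGamma1 f ↔ (z ∈ periodLatticeGamma1 f ↔ w ∈ periodLatticeGamma1 f)) := by
    intro z w hz hw
    rcases htwo z hz with hz1 | hz1 <;> rcases htwo w hw with hw1 | hw1
    · exact ⟨fun _ ↦ ⟨fun _ ↦ hw1, fun _ ↦ hz1⟩, fun _ ↦ add_mem hz1 hw1⟩
    · refine ⟨fun hzw ↦ ⟨fun _ ↦ by simpa using sub_mem hzw hz1, fun _ ↦ hz1⟩, fun hiff ↦ add_mem hz1 (hiff.mp hz1)⟩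
    · refine ⟨fun hzw ↦ ⟨fun _ ↦ hw1, fun _ ↦ by simpa using sub_mem hzw hw1⟩, fun hiff ↦ add_mem (hiff.mpr hw1) hw1⟩
    · have hzw : z + w ∈ periodLatticeGamma1 f := by
        have e : z + w = (z - x₀) + (w - x₀) + 2 * x₀ := by ring
        rw [e]; exact add_mem (add_mem hz1 hw1) h2x₀
      refine ⟨fun _ ↦ ⟨fun hzm ↦ ?_, fun hwm ↦ ?_⟩, fun _ ↦ hzw⟩
      · have hx : x₀ ∈ periodLatticeGamma1 f := by simpa using sub_mem hzm hz1
        simpa using add_mem hw1 hx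
      · have hx : x₀ ∈ periodLatticeGamma1 f := by simpa using sub_mem hwm hw1
        simpa using add_mem hz1 hx
  -- the sign homomorphism
  let s : (ZMod N)ˣ → ℤˣ := fun u ↦ if cuspSymbol f (g u) ∈ periodLatticeGamma1 f then 1 else -1
  have hs_one : s 1 = 1 := by
    simp only [s]
    rw [if_pos (cuspSymbol_mem_periodLatticeGamma1_of_apply_eq_one f _ (by rw [hg]; simp))]
  have hs_mul : ∀ u v, s (u * v) = s u * s v := by
    intro u v
    have hmul : cuspSymbol f (g (u * v)) ∈ periodLatticeGamma1 f ↔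
        (cuspSymbol f (g u) ∈ periodLatticeGamma1 f ↔ cuspSymbol f (g v) ∈ periodLatticeGamma1 f) := by
      have h1 := hclass (g u * g v) (u * v) (by rw [apply_one_one_mul_eq, hg, hg, Units.val_mul])
      rw [cuspSymbol_mul_holds f] at h1
      rw [← h1]
      exact hsum (cuspSymbol_mem_periodLattice f (g u)) (cuspSymbol_mem_periodLattice f (g v))
    by_cases hu : cuspSymbol f (g u) ∈ periodLatticeGamma1 f <;>
      by_cases hv : cuspSymbol f (g v) ∈ periodLatticeGamma1 f
    · have huv : cuspSymbol f (g (u * v)) ∈ periodLatticeGamma1 f := hmul.mpr ⟨fun _ ↦ hv, fun _ ↦ hu⟩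
      simp only [s, if_pos hu, if_pos hv, if_pos huv, mul_one]
    · have huv : cuspSymbol f (g (u * v)) ∉ periodLatticeGamma1 f := fun h ↦ hv ((hmul.mp h).mp hu)
      simp only [s, if_pos hu, if_neg hv, if_neg huv, one_mul]
    · have huv : cuspSymbol f (g (u * v)) ∉ periodLatticeGamma1 f := fun h ↦ hu ((hmul.mp h).mpr hv)
      simp only [s, if_neg hu, if_pos hv, if_neg huv, mul_one]
    · have huv : cuspSymbol f (g (u * v)) ∈ periodLatticeGamma1 f :=
        hmul.mpr ⟨fun h ↦ absurd h hu, fun h ↦ absurd h hv⟩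
      simp only [s, if_neg hu, if_neg hv, if_pos huv, neg_mul, one_mul, neg_neg]
  let φ : (ZMod N)ˣ →* ℤˣ := { toFun := s, map_one' := hs_one, map_mul' := hs_mul }
  refine ⟨MulChar.ofUnitHom φ, fun γ ↦ ?_⟩
  have hu := isUnit_apply_one_one γ
  have hc := hclass γ hu.unit hu.unit_spec.symm
  rw [← hu.unit_spec, MulChar.ofUnitHom_coe]
  show ((s hu.unit : ℤˣ) : ℤ) = 1 ↔ _
  by_cases hm : cuspSymbol f (g hu.unit) ∈ periodLatticeGamma1 f
  · simp only [s, if_pos hm, Units.val_one, true_iff]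
    exact hc.mpr hm
  · simp only [s, if_neg hm, Units.val_neg, Units.val_one]
    constructor
    · intro h; norm_num at h
    · intro h; exact absurd (hc.mp h) hm

/-- **Two classes ⟹ the period class is a Kronecker symbol** (`4 ∣ N`): for one admissible squarefree `q ∣ N`,
`{∞, γ∞}_f ∈ Λ₁(f) ⟺ (q | d_γ) = +1`. [cite: LingOesterle1991, §1 and Thm. 1] [cite: Stevens1989, §2] -/
theorem exists_jacobiSym_represents_of_two_classes (h4 : 4 ∣ N) {x₀ : ℂ} (h2x₀ : 2 * x₀ ∈ periodLatticeGamma1 f)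
    (htwo : ∀ z ∈ periodLattice f, z ∈ periodLatticeGamma1 f ∨ z - x₀ ∈ periodLatticeGamma1 f) :
    ∃ q : ℕ, Squarefree q ∧ q ∣ N ∧ (¬ 32 ∣ N → Odd q) ∧ (¬ 8 ∣ N → q % 4 = 1) ∧
      ∀ γ : Gamma0 N, cuspSymbol f γ ∈ periodLatticeGamma1 f ↔ J(q | (((γ : SL(2, ℤ)) 1 1 : ℤ)).natAbs) = 1 := by
  obtain ⟨χ, hχ⟩ := exists_dirichletChar_represents_of_two_classes f h2x₀ htwo
  exact exists_jacobiSym_represents_of_represents f h4 χ hχ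

/-- **At the cyclic levels of the cuspidal-inertia reduction** (`N = u²v`, `4 ∣ N`, units of `ℤ/uv` of the form `± u₀^k`, `2Λ₀(f) ⊆ Λ₁(f)`
— e.g. every NEWFORM at `N = 4p^e, 8p^e, 16p^e, 32, 64, 128, 256`): the period class of `f` is a Kronecker symbol `(q | d_γ)` for one admissible
squarefree `q ∣ N`. [cite: LingOesterle1991, §1, Thm. 1 and Thm. 6] -/
theorem exists_jacobiSym_represents_of_generator_mod {u v m : ℕ} (hu : u ≠ 0)
    (hN : (N : ℤ) = (u : ℤ) ^ 2 * v) (hm : u * v = m) {u₀ : ZMod m} (hu₀ : IsUnit u₀)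
    (hgen : ∀ w : (ZMod m)ˣ, ∃ k : ℕ, (w : ZMod m) = u₀ ^ k ∨ (w : ZMod m) = -(u₀ ^ k))
    (h2 : ∀ z ∈ periodLattice f, (2 : ℂ) * z ∈ periodLatticeGamma1 f) (h4 : 4 ∣ N) :
    ∃ q : ℕ, Squarefree q ∧ q ∣ N ∧ (¬ 32 ∣ N → Odd q) ∧ (¬ 8 ∣ N → q % 4 = 1) ∧
      ∀ γ : Gamma0 N, cuspSymbol f γ ∈ periodLatticeGamma1 f ↔ J(q | (((γ : SL(2, ℤ)) 1 1 : ℤ)).natAbs) = 1 := by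
  subst hm
  obtain ⟨γ₀, hγ₀⟩ := exists_forall_mem_or_sub_mem_periodLatticeGamma1_of_generator_mod f hu hN hu₀ hgen h2
  exact exists_jacobiSym_represents_of_two_classes f h4 (h2 _ (cuspSymbol_mem_periodLattice f γ₀)) hγ₀

/-- **Newform form**: for a newform `f` on `Γ₀(N)` at a cyclic level (`N = u²v`, units of `ℤ/uv` `= ± u₀^k`, `4 ∣ N`) the traceless prime `2`
gives `2Λ₀ ⊆ Λ₁` (tree `pMulLatticeLeGamma1OfTracelessPrime_holds`), so the period class of `f` is a Kronecker symbol.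
[cite: LingOesterle1991, Thm. 1 and Thm. 6] -/
theorem exists_jacobiSym_represents_of_generator_mod_of_isNewform0 {u v m : ℕ} (hu : u ≠ 0)
    (hN : (N : ℤ) = (u : ℤ) ^ 2 * v) (hm : u * v = m) {u₀ : ZMod m} (hu₀ : IsUnit u₀)
    (hgen : ∀ w : (ZMod m)ˣ, ∃ k : ℕ, (w : ZMod m) = u₀ ^ k ∨ (w : ZMod m) = -(u₀ ^ k))
    (hf : IsNewform0 f) (h4 : 4 ∣ N) :
    ∃ q : ℕ, Squarefree q ∧ q ∣ N ∧ (¬ 32 ∣ N → Odd q) ∧ (¬ 8 ∣ N → q % 4 = 1) ∧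
      ∀ γ : Gamma0 N, cuspSymbol f γ ∈ periodLatticeGamma1 f ↔ J(q | (((γ : SL(2, ℤ)) 1 1 : ℤ)).natAbs) = 1 := by
  have h4' : 2 ^ 2 ∣ N := by simpa using h4
  refine exists_jacobiSym_represents_of_generator_mod f hu hN hm hu₀ hgen (fun z hz ↦ ?_) h4
  have h := pMulLatticeLeGamma1OfTracelessPrime_holds N f hf 2 Nat.prime_two
    ((dvd_pow_self 2 two_ne_zero).trans h4') (hf.cuspCoeff_eq_zero_of_sq_dvd Nat.prime_two h4') z hz
  exact_mod_cast h

end Summit.BirchSwinnertonDyer.BirchSwinnertonDyer.Theorems.ManinLocalTwoThree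

end
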